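import Summits.NavierStokesRegularity.NavierStokesRegularity.Theorems.ScenarioCensusRowF13dLargeL3Cell
import Summits.NavierStokesRegularity.NavierStokesRegularity.Theorems.AxisymmetricExtremalityPFoldToAxisymmetricCompactModuloSim

/-!
# Scenario census, sub-row F13dL — part 2/3: Corollary D (Rusin–Šverák minimal blow-up data are not dihedral of large
# order; the «2-group reshape» `navierStokesRegularity_of_minimalDatumDihedralFold`) and Corollary K (the cell in Kato's
# critical `L³` class, S1ᴷ `normalisedBadSequenceK`)

Port (typer seat ns-census-typer-1 g6; lead g8 GO 2026-08-28T18:02Z, split «file 2 + keys» agreed with typer-2 g8 18:04Z) of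
the ideator's tree-ready kit file 2 `pub/ideators/ns-idea-9/lines/dihedral_noswirl/landing/ScenarioCensusRowF13dLargeL3.lean`
(ns-idea-9 g6, LINE 14 «dihedral_noswirl» REV 8 bef4d09e9c956928; kit file sha16 c3e138e50225bf3d, 925 l.; ref g7 PRE-CHECK ✓
§12.34 / §12.41, critic idea-crit-8 V56/V57/V58 PASS), on top of typer-2 g8's port of kit file 1
(`Theorems/ScenarioCensusLargeOrderRigidity.lean` and its parts, namespace `…ScenarioCensus.LargeOrderRigidity`).  Split for the
400-line rule into THREE modules: `ScenarioCensusRowF13dLargeL3Cell` (part 1) ← `ScenarioCensusRowF13dLargeL3Minimal` (part 2,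
a leaf: the only part importing a module in the cone of route file `Theses/AxisymmetricExtremality.lean`) and part 1 ←
`ScenarioCensusRowF13dLargeL3` (part 3, the kit's name; it also carries the census keys in namespace `…ScenarioCensus`, which
therefore stay outside that cone).
Declarations VERBATIM in the kit's namespace `…Theorems.ScenarioCensus.RowF13dLargeL3`; the only edits: the kit's
`local notation "ℝ³"` is spelled with the tree abbreviation `LargeOrderRigidity.R3` (typer lint: no notation), and one-line
docstrings are added to two undocumented auxiliaries (`avgSeq_comp`, `measurableSet_parabolicCylinder`), and — to keep parts 1 and 3
(hence the census keys) OUT of the cone of route file `Theses/AxisymmetricExtremality.lean` — the single use of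
`PFoldToAxisymmetric.AeAxisymmetricUpgrade.hasGlobalKatoSolution_congr_ae` in `hasGlobalKatoSolution_of_aeDihedral` (part 1) is served by
the route-independent tree lemma `HasGlobalKatoSolution.congr_datum_ae` (same statement up to `symm`; that module's Literature imports are
imported directly); every statement is unchanged.

This part: **D** `minimalData_not_dihedral_of_large_order` — for every `ν > 0` there is `N` such that no Rusin–Šverák
minimal blow-up datum is `D_p`-symmetric for `p ≥ N` (tree `PFoldToAxisymmetric.CompactModuloSim.stub_compactModuloSim` +
S2ᴰ + part 1's `hasGlobalKatoSolution_of_aeDihedral`); the dihedralised Smith-type crux `MinimalDatumDihedralFold` is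
DEFINED, NOT asserted, NOT claimed tractable, with `minimalDatumPFold_of_dihedralFold` (⇒ the route's crux BY NAME) and the
kernel-checked one-crux reshape `navierStokesRegularity_of_minimalDatumDihedralFold : MinimalDatumDihedralFold →
NavierStokesRegularity` (a CONDITIONAL composition — its hypothesis is an open crux; nothing unconditional about the summit);
**K** `hasGlobalKatoSolution_dihedral_of_large_order` — every weakly divergence-free `D_p`-symmetric `u₀ ∈ L³`,
`‖u₀‖₃ ≤ K ν`, `p ≥ N(ν, K)`, has a GLOBAL Kato solution (S1ᴷ via the tree's `exists_singularPoint_katoMaximalTime`).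

**NOT THE ROW:** the census row `Row_F13mLarge` (neither mirror nor budget), `Row_F0`, `Row_F5` are untouched and stay
OPEN; NS regularity is NOT proved; no summit statement is proved in this file.
-/

noncomputable section

set_option linter.dupNamespace false
set_option linter.unusedVariables false

open Set Function Filter Topology MeasureTheory Metric TopologicalSpace
open scoped NNReal ENNReal RealInnerProductSpace

namespace Summit.NavierStokesRegularity.NavierStokesRegularity.Theorems.ScenarioCensus.RowF13dLargeL3

open Literature.Analysis Literature.Analysis.FluidPDE
open Summit.NavierStokesRegularity.NavierStokesRegularity.Theorems.ScenarioCensus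
open Summit.NavierStokesRegularity.NavierStokesRegularity.Theorems.ScenarioCensus.LargeOrderRigidity
open Summit.NavierStokesRegularity.NavierStokesRegularity.Theorems.AxisymmetricKatoGlobal.NoSwirlStratum
open Summit.NavierStokesRegularity.NavierStokesRegularity.Theorems.PFoldToAxisymmetric

/-! ## Corollary D (rev 5) — Rusin–Šverák MINIMAL blow-up data cannot be dihedrally symmetric of large order;
the «2-group reshape» of route AxisymmetricExtremality closes from its Smith-type crux ALONE

Route AxisymmetricExtremality (`Theses/AxisymmetricExtremality.lean`) closes the summit from three cruxes:
`MinimalDatumPFold` (Smith theory on `M/Sim`: Clay failure ⇒ `p`-fold minimal blow-up data for unboundedly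
many `p`; OPEN), `PFoldToAxisymmetric` (PROVED in the tree) and `AxisymmetricKatoGlobal` (axisymmetric WITH
swirl; OPEN — the same wall as LINE 13's residual).  Its crux notes (`Cruxes/MinimalDatumPFold/EQUIVALENCE-
VERDICT.md` §2, `Lines/symmetric-gap.md`) record the «dihedral / 2-group reshape»: with `Z_p` replaced by a
dihedral group the limiting datum would be swirl-free and `AxisymmetricKatoGlobal` would be replaced by KNOWN
no-swirl regularity — "PFold′ needed verbatim with `Z_p` replaced by their 2-groups".  Corollary D below IS that
PFold′-with-no-swirl composite, as a kernel theorem: the strong `L³` compactness of minimal data modulo `Sim`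
(tree, `PFoldToAxisymmetric.CompactModuloSim.stub_compactModuloSim`, PROVED) feeds this file's S2ᴰ
(`profileRigidityD`, weak form — strong convergence is more than enough, and the budget is automatic on a
convergent sequence) and `hasGlobalKatoSolution_of_aeDihedral`.  Consequently the reshaped route needs ONLY
its Smith-type crux, dihedralised (`MinimalDatumDihedralFold` below, NOT asserted here):
`navierStokesRegularity_of_minimalDatumDihedralFold`.  Whether the dihedralised Smith crux is any more
tractable than the cyclic one is exactly the question those crux notes weigh (cdisprove §3b there:
the abstract extremality step meets the same free-orbit toy obstruction); this file takes no position. -/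

/-- **Corollary D (rev 5).**  For every `ν > 0` there is an order `N` such that NO Rusin–Šverák minimal blow-up
datum (`IsMinimalBlowupDatum ν u₀ g`) is `D_p`-symmetric — `p`-fold equivariant about the `x₃`-axis AND
mirror-equivariant under `σ = reflY` — for any `p ≥ N` (formally: a `p`-fold equivariant minimal datum with
`p ≥ N` is NOT mirror-equivariant).  Proof: otherwise choose such data along `p_N ≥ N`;
modulate by `Sim` and pass to a STRONG `L³`-limit `u ∈ M` (tree: `stub_compactModuloSim`); the modulated data
are `D_{p_j}`-symmetric about the moved vertical axes / meridian planes (`normalise_conj_rotZ/reflY`), bounded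
in `L³` along a tail (strong convergence), and converge weakly; S2ᴰ (`profileRigidityD`) makes `u`
a.e.-axisymmetric and a.e.-mirror-symmetric about some vertical axis; `hasGlobalKatoSolution_of_aeDihedral`
gives `u` a global Kato solution — contradicting the minimality clause `¬ HasGlobalKatoSolution ν u`. -/
theorem minimalData_not_dihedral_of_large_order (ν : ℝ) (hν : 0 < ν) :
    ∃ N : ℕ, ∀ p : ℕ, N ≤ p →
      ∀ (u₀ : R3 → R3) (g : FunctionSpaces.HomSobolev R3 (EuclideanSpace ℂ (Fin 3)) (1 / 2 : ℝ)),
        IsMinimalBlowupDatum ν u₀ g →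
        (∀ x : R3, u₀ (rotZ (2 * Real.pi / p) x) = rotZ (2 * Real.pi / p) (u₀ x)) →
        ¬ ∀ x : R3, u₀ (reflY x) = reflY (u₀ x) := by
  by_contra h
  push Not at h
  choose p hp u₀ g hmin hsym hmir using h
  -- strong `L³` compactness of minimal data modulo `Sim` (tree)
  obtain ⟨lam, x₀, φ, u, g', hlam, hφ, hminu, hconv⟩ :=
    CompactModuloSim.stub_compactModuloSim ν hν u₀ g hmin
  obtain ⟨hu3, -, hudiv, -, hno⟩ := hminu
  -- the modulated data `a_j = λ_j u₀^{φ j}(λ_j · − x₀^j)`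
  set a : ℕ → R3 → R3 := fun j => rescaleData (lam j) fun y => u₀ (φ j) (y - x₀ j) with ha_def
  have ha3 : ∀ j, MemLp (a j) 3 volume := fun j =>
    memLp_three_rescaleData
      ((hmin (φ j)).1.comp_measurePreserving (measurePreserving_sub_right volume (x₀ j))) (hlam j)
  have hconv' : Tendsto (fun j => eLpNorm (a j - u) 3 volume) atTop (𝓝 0) := hconv
  -- a tail on which `‖a_j − u‖₃ < 1`, hence a uniform `L³` bound `M = 1 + ‖u‖₃`
  obtain ⟨J, hJ⟩ := eventually_atTop.1 ((tendsto_order.1 hconv').2 1 zero_lt_one)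
  have hutop : 1 + eLpNorm u 3 volume ≠ ⊤ := ENNReal.add_ne_top.2 ⟨ENNReal.one_ne_top, hu3.eLpNorm_ne_top⟩
  set M : ℝ≥0 := (1 + eLpNorm u 3 volume).toNNReal with hM
  have hMeq : (M : ℝ≥0∞) = 1 + eLpNorm u 3 volume := ENNReal.coe_toNNReal hutop
  have hbound : ∀ j, eLpNorm (a (J + j)) 3 volume ≤ (M : ℝ≥0∞) := fun j => by
    rw [hMeq]
    calc eLpNorm (a (J + j)) 3 volume = eLpNorm ((a (J + j) - u) + u) 3 volume := by rw [sub_add_cancel]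
      _ ≤ eLpNorm (a (J + j) - u) 3 volume + eLpNorm u 3 volume :=
          eLpNorm_add_le ((ha3 _).1.sub hu3.1) hu3.1 (by norm_num)
      _ ≤ 1 + eLpNorm u 3 volume := by gcongr; exact (hJ _ (Nat.le_add_right _ _)).le
  -- the modulated data are `D_{p (φ j)}`-symmetric about the moved axis / meridian plane
  have hsymA : ∀ j, IsCyclicEquivariantAbout (p (φ j)) (axisCentre (lam j) (-x₀ j)) (a j) := by
    intro j y
    have h1 := normalise_conj_rotZ (hlam j).ne' (-x₀ j) y (2 * Real.pi / p (φ j))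
    simp only [neg_neg] at h1
    show lam j • u₀ (φ j) (lam j • (axisCentre (lam j) (-x₀ j) +
        rotZ (2 * Real.pi / p (φ j)) (y - axisCentre (lam j) (-x₀ j))) - x₀ j) =
      rotZ (2 * Real.pi / p (φ j)) (lam j • u₀ (φ j) (lam j • y - x₀ j))
    rw [h1, hsym, rotZ_smul']
  have hmirA : ∀ j, IsMirrorEquivariantAbout (axisCentre (lam j) (-x₀ j)) (a j) := by
    intro j y
    have h1 := normalise_conj_reflY (hlam j).ne' (-x₀ j) y
    simp only [neg_neg] at h1
    show lam j • u₀ (φ j) (lam j • (axisCentre (lam j) (-x₀ j) +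
        reflY (y - axisCentre (lam j) (-x₀ j))) - x₀ j) = reflY (lam j • u₀ (φ j) (lam j • y - x₀ j))
    rw [h1, hmir, map_smul]
  -- weak convergence of the tail to `u` (strong convergence + Hölder `(3, 3/2)`)
  have hweak : ∀ ψ : R3 → R3, FunctionSpaces.IsTestFunctionOn (⊤ : Opens R3) ψ →
      Tendsto (fun j => ∫ x, ⟪a (J + j) x, ψ x⟫) atTop (𝓝 (∫ x, ⟪u x, ψ x⟫)) := by
    intro ψ hψ
    have hψ32 : MemLp ψ (3 / 2 : ℝ≥0∞) volume := testFun_memLp hψ _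
    have hlim : Tendsto (fun j => (eLpNorm (a (J + j) - u) 3 volume).toReal *
        (eLpNorm ψ (3 / 2 : ℝ≥0∞) volume).toReal) atTop (𝓝 0) := by
      have h0 : Tendsto (fun j => eLpNorm (a (J + j) - u) 3 volume) atTop (𝓝 0) :=
        hconv'.comp (tendsto_atTop_atTop.2 fun b => ⟨b, fun j hj => hj.trans (Nat.le_add_left j J)⟩)
      have h1 := (ENNReal.tendsto_toReal ENNReal.zero_ne_top).comp h0
      rw [ENNReal.toReal_zero] at h1
      simpa using h1.mul_const (eLpNorm ψ (3 / 2 : ℝ≥0∞) volume).toReal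
    rw [tendsto_iff_norm_sub_tendsto_zero]
    refine squeeze_zero' (Eventually.of_forall fun j => norm_nonneg _)
      (Eventually.of_forall fun j => ?_) hlim
    rw [Real.norm_eq_abs, ← integral_sub (integrable_inner_test (ha3 _) hψ) (integrable_inner_test hu3 hψ)]
    simp only [← inner_sub_left]
    exact FunctionSpaces.abs_integral_inner_le_eLpNorm_three_mul_threeHalves ((ha3 _).sub hu3) hψ32
  -- the orders of symmetry diverge along the tail
  have hm' : Tendsto (fun j => p (φ (J + j))) atTop atTop :=
    tendsto_atTop_mono (fun j => ((Nat.le_add_left j J).trans (hφ.id_le _)).trans (hp _)) tendsto_id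
  -- S2ᴰ: the strong limit is a.e.-dihedral about some vertical axis; hence globally Kato-regular
  obtain ⟨ξ, -, hax, hmirr⟩ := profileRigidityD (M := M) (m := fun j => p (φ (J + j)))
    (c := fun j => axisCentre (lam (J + j)) (-x₀ (J + j))) (a := fun j => a (J + j)) (f := u)
    hm' (fun j => axisCentre_apply_two _ _) (fun j => ⟨ha3 _, hbound j⟩) (fun j => hsymA _)
    (fun j => hmirA _) hu3 hweak
  exact hno (hasGlobalKatoSolution_of_aeDihedral hν hu3 hudiv hax hmirr)

/-- The Smith-type crux `AxisymmetricExtremality.MinimalDatumPFold` of route AxisymmetricExtremality with its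
conclusion DIHEDRALISED (the «2-group reshape» of `Cruxes/MinimalDatumPFold/EQUIVALENCE-VERDICT.md` §2):
Clay failure at `ν` (antecedent VERBATIM from `MinimalDatumPFold`) ⇒ for every `N` a `D_p`-symmetric
(`p ≥ N`, `p ≥ 2`; `p`-fold about the `x₃`-axis, `rotZ`, AND mirror `reflY`) Rusin–Šverák minimal blow-up
datum.  NOT asserted and NOT claimed tractable here — a candidate replacement crux, recorded so that the
reshape's deciding theorem can be kernel-checked (`navierStokesRegularity_of_minimalDatumDihedralFold`). -/
def MinimalDatumDihedralFold : Prop :=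
  ∀ ν : ℝ, 0 < ν → (∃ v₀ : EuclideanSpace ℝ (Fin 3) → EuclideanSpace ℝ (Fin 3), ContDiff ℝ (⊤ : ℕ∞) v₀ ∧ Literature.Analysis.FluidPDE.NSWave0.IsDivFree v₀ ∧ Literature.Analysis.FluidPDE.HasRapidSpatialDecay v₀ ∧ ¬ ∃ (u : ℝ → EuclideanSpace ℝ (Fin 3) → EuclideanSpace ℝ (Fin 3)) (p : ℝ → EuclideanSpace ℝ (Fin 3) → ℝ), Literature.Analysis.FluidPDE.IsSmoothOnHalfSpace u ∧ Literature.Analysis.FluidPDE.IsSmoothOnHalfSpace p ∧ Literature.Analysis.FluidPDE.IsNavierStokesSolution ν 0 v₀ u p ∧ Literature.Analysis.FluidPDE.HasBoundedEnergy u) → ∀ N : ℕ, ∃ p : ℕ, N ≤ p ∧ 2 ≤ p ∧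
    ∃ (u₀ : R3 → R3) (g : FunctionSpaces.HomSobolev R3 (EuclideanSpace ℂ (Fin 3)) (1 / 2 : ℝ)),
      IsMinimalBlowupDatum ν u₀ g ∧
        (∀ x : R3, u₀ (rotZ (2 * Real.pi / p) x) = rotZ (2 * Real.pi / p) (u₀ x)) ∧
        ∀ x : R3, u₀ (reflY x) = reflY (u₀ x)

/-- The dihedralised crux implies the route's cyclic crux `MinimalDatumPFold` BY NAME (drop the mirror; the
route writes the rotation out in coordinates, which is `rotZ` unfolded). -/
theorem minimalDatumPFold_of_dihedralFold (h : MinimalDatumDihedralFold) :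
    Theses.AxisymmetricExtremality.MinimalDatumPFold := by
  intro ν hν hclay N
  obtain ⟨p, hNp, h2p, u₀, g, hmin, hsym, -⟩ := h ν hν hclay N
  exact ⟨p, hNp, h2p, u₀, g, hmin, fun x => hsym x⟩

/-- **The 2-group reshape of route AxisymmetricExtremality decides the summit from ONE crux** (kernel-checked
composition; the crux itself is NOT proved): `MinimalDatumDihedralFold → NavierStokesRegularity`, by Corollary D.
Compare the route's `closes : MinimalDatumPFold → PFoldToAxisymmetric → AxisymmetricKatoGlobal → NS` — the open
PDE crux `AxisymmetricKatoGlobal` (axisymmetric WITH swirl) does not occur here. -/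
theorem navierStokesRegularity_of_minimalDatumDihedralFold (h : MinimalDatumDihedralFold) :
    _root_.NavierStokesRegularity := by
  show Literature.NS.NavierStokesExistenceSmoothR3
  intro ν hν v₀ hsm hdiv hdec
  by_contra hno
  obtain ⟨N, hN⟩ := minimalData_not_dihedral_of_large_order ν hν
  obtain ⟨p, hNp, -, u₁, g, hmin, hsym, hmir⟩ := h ν hν ⟨v₀, hsm, hdiv, hdec, hno⟩ N
  exact hN p hNp u₁ g hmin hsym hmir

/-! ## Corollary K (rev 6) — the cell in Kato's critical `L³` class

The same mechanism decides the dihedral large-order cell in the natural critical class: **for every `ν > 0`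
and `K ≥ 0` there is `N` such that every weakly divergence-free `u₀ ∈ L³(ℝ³)` with `‖u₀‖₃ ≤ Kν` that is
`D_p`-symmetric (`p`-fold about the vertical axis and mirror-symmetric in the plane `{x₁ = 0}`) for some
`p ≥ N` has a GLOBAL Kato solution.**  The only change w.r.t. `row_F13dLargeL3_holds` is step S1: the
singular point of a non-global datum now comes from the tree's `exists_singularPoint_katoMaximalTime`
(maximal Kato solution on `[0, T_max)` with a singular point at time `T_max`; discharged facts
`kato_local_holds`, `IsKatoSolutionOn.continuation_of_bounded_holds`, `IsKatoSolutionOn.farField_bound_holds`)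
instead of the classical blow-up alternative.  NOT THE ROW (no statement about `Row_F13mLarge`, which has
neither the mirror nor the budget); no summit statement is proved. -/

section KatoClass

/-- **S1ᴷ (normalised bad sequence, Kato class; PROVED).**  As `normalisedBadSequenceD`, for data in
Kato's class: the singular point is supplied by `exists_singularPoint_katoMaximalTime`. -/
theorem normalisedBadSequenceK {ν K : ℝ} (hν : 0 < ν)
    (hbad : ∀ m₀ : ℕ, ∃ m : ℕ, m₀ ≤ m ∧ ∃ u₀ : R3 → R3, MemLp u₀ 3 volume ∧ IsWeaklyDivFree u₀ ∧
        (∀ x : R3, u₀ (rotZ (2 * Real.pi / m) x) = rotZ (2 * Real.pi / m) (u₀ x)) ∧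
        (∀ x : R3, u₀ (reflY x) = reflY (u₀ x)) ∧
        eLpNorm u₀ 3 volume ≤ ENNReal.ofReal (K * ν) ∧ ¬ HasGlobalKatoSolution ν u₀) :
    ∃ (m : ℕ → ℕ) (c : ℕ → R3) (a : ℕ → R3 → R3) (w : ℕ → ℝ → R3 → R3) (q : ℕ → ℝ → R3 → ℝ),
      Tendsto m atTop atTop ∧ (∀ j, c j 2 = 0) ∧
      (∀ j, MemLp (a j) 3 volume ∧ IsWeaklyDivFree (a j) ∧
        eLpNorm (a j) 3 volume ≤ ((K * ν).toNNReal : ℝ≥0∞)) ∧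
      (∀ j, IsLocalLeraySolution ν (a j) (w j) (q j)) ∧
      (∀ j, IsCyclicEquivariantAbout (m j) (c j) (a j)) ∧
      (∀ j, IsMirrorEquivariantAbout (c j) (a j)) ∧
      (∀ j (r : ℝ), 0 < r →
        eLpNorm (uncurry (w j)) ∞ (volume.restrict (parabolicCylinder r ((1 : ℝ), (0 : R3)))) = ∞) := by
  classical
  -- bad data at orders `m_j ≥ j`
  choose m hm u₀ h3 hdiv0 hsym hmir hbud hng using hbad
  -- maximal Kato solutions with a singular point `(T_j, x_j)`, `T_j = T_max(u₀ j)`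
  have hmax : ∀ j, ∃ T : ℝ, 0 < T ∧ ∃ (x₀ : R3) (u : ℝ → R3 → R3), IsKatoSolutionOn T ν (u₀ j) u ∧
      ∀ r : ℝ, 0 < r → eLpNorm (uncurry u) ∞ (volume.restrict (parabolicCylinder r ((T : ℝ), x₀))) = ∞ := by
    intro j
    obtain ⟨hpos, htop, xs, u, hu, hsing⟩ := exists_singularPoint_katoMaximalTime kato_local_holds
      IsKatoSolutionOn.continuation_of_bounded_holds IsKatoSolutionOn.farField_bound_holds hν (h3 j)
      (hdiv0 j) (hng j)
    exact ⟨_, ENNReal.toReal_pos hpos.ne' htop.ne, xs, u, hu, hsing⟩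
  choose T hT x u hK hx using hmax
  -- scales `λ_j = √T_j`
  set lam : ℕ → ℝ := fun j => Real.sqrt (T j) with hlam_def
  have hlam : ∀ j, 0 < lam j := fun j => Real.sqrt_pos.2 (hT j)
  have hlam2 : ∀ j, lam j ^ 2 = T j := fun j => Real.sq_sqrt (hT j).le
  -- normalised data and Kato solutions on `[0, 1)`
  set a : ℕ → R3 → R3 := fun j => rescaleData (lam j) fun y => u₀ j (y - -x j) with ha_def
  set v : ℕ → ℝ → R3 → R3 := fun j t y => lam j • u j (lam j ^ 2 * t) (lam j • y - -x j) with hv_def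
  have hK1 : ∀ j, IsKatoSolutionOn 1 ν (a j) (v j) := by
    intro j
    obtain ⟨h1, h2, h3', h4⟩ := kato_local_rescale_translate (hK j).mild (hK j).continuousInLpOn
      (hK j).initial (hK j).aestronglyMeasurable (hlam j) (-x j)
    have h1T : T j / lam j ^ 2 = 1 := by rw [hlam2, div_self (hT j).ne']
    rw [h1T] at h1 h2 h4
    exact ⟨h1, h2, h3', h4⟩
  have ha3 : ∀ j, MemLp (a j) 3 volume := fun j => by
    have h := (hK1 j).memLp (t := 0) ⟨le_rfl, one_pos⟩
    rwa [(hK1 j).initial] at h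
  have hdiv : ∀ j, IsWeaklyDivFree (a j) := fun j => by
    have h := (hK1 j).mild.1 0 ⟨le_rfl, one_pos⟩
    rwa [(hK1 j).initial] at h
  have hnorm : ∀ j, eLpNorm (a j) 3 volume ≤ ((K * ν).toNNReal : ℝ≥0∞) := fun j => by
    have hmeas : AEStronglyMeasurable (u₀ j) volume := (h3 j).1
    have e1 : eLpNorm (a j) 3 volume = eLpNorm (fun y => u₀ j (y - -x j)) 3 volume :=
      eLpNorm_three_rescaleData _ (hlam j)
    have e2 : eLpNorm (fun y => u₀ j (y - -x j)) 3 volume = eLpNorm (u₀ j) 3 volume :=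
      eLpNorm_comp_measurePreserving (g := u₀ j) (f := fun y : R3 => y - -x j) hmeas
        (measurePreserving_sub_right volume (-x j))
    rw [e1, e2]
    exact hbud j
  -- local Leray solutions a.e. equal to the normalised Kato solutions on `(0, 1) × ℝ³`
  have hLer : ∀ j, ∃ (w : ℝ → R3 → R3) (q : ℝ → R3 → ℝ), IsLocalLeraySolution ν (a j) w q ∧
      uncurry w =ᵐ[volume.restrict (Ioo 0 1 ×ˢ (univ : Set R3))] uncurry (v j) := fun j =>
    leray_solution_exists_ae_eq_kato_holds hν one_pos (ha3 j) (hdiv j) (hK1 j)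
  choose w q hw hae using hLer
  -- the normalised Kato solutions are singular at `(1, 0)`
  have hvsing : ∀ j (r : ℝ), 0 < r →
      eLpNorm (uncurry (v j)) ∞ (volume.restrict (parabolicCylinder r ((1 : ℝ), (0 : R3)))) = ∞ := by
    intro j r hr
    have h := eLpNorm_top_uncurry_rescale_translate (u j) (hlam j) (-x j) r 1 0
    have e1 : (lam j ^ 2 * 1 : ℝ) = T j := by rw [mul_one, hlam2]
    have e2 : lam j • (0 : R3) - -x j = x j := by rw [smul_zero, sub_neg_eq_add, zero_add]
    rw [e1, e2, hx j (lam j * r) (mul_pos (hlam j) hr),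
      ENNReal.mul_top (enorm_ne_zero.2 (hlam j).ne')] at h
    exact h
  -- hence so are the local Leray solutions
  have hwsing : ∀ j (r : ℝ), 0 < r →
      eLpNorm (uncurry (w j)) ∞ (volume.restrict (parabolicCylinder r ((1 : ℝ), (0 : R3)))) = ∞ := by
    intro j r hr
    refine eLpNorm_top_parabolicCylinder_eq_top_of_small one_pos (fun ρ hρ hρ1 => ?_) hr
    rw [eLpNorm_congr_ae (ae_restrict_of_ae_restrict_of_subset
      (parabolicCylinder_one_subset_strip hρ1) (hae j))]
    exact hvsing j ρ hρ
  -- the package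
  refine ⟨m, fun j => axisCentre (lam j) (x j), a, w, q, ?_, fun j => rfl, fun j =>
    ⟨ha3 j, hdiv j, hnorm j⟩, hw, fun j => ?_, fun j => ?_, hwsing⟩
  · exact tendsto_atTop_atTop.2 fun b => ⟨b, fun j hj => le_trans hj (hm j)⟩
  · -- equivariance about the moved axis
    intro y
    show lam j • u₀ j (lam j • (axisCentre (lam j) (x j) +
        rotZ (2 * Real.pi / m j) (y - axisCentre (lam j) (x j))) - -x j) =
      rotZ (2 * Real.pi / m j) (lam j • u₀ j (lam j • y - -x j))
    rw [normalise_conj_rotZ (hlam j).ne', hsym j, rotZ_smul']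
  · -- mirror-equivariance about the moved plane
    intro y
    show lam j • u₀ j (lam j • (axisCentre (lam j) (x j) +
        reflY (y - axisCentre (lam j) (x j))) - -x j) =
      reflY (lam j • u₀ j (lam j • y - -x j))
    rw [normalise_conj_reflY (hlam j).ne', hmir j, map_smul]

/-- **COROLLARY K (rev 6, PROVED): the dihedral large-order cell in Kato's critical class.**  For every
`ν > 0` and budget `K` there is an order `N` such that every weakly divergence-free `u₀ ∈ L³(ℝ³)` with
`‖u₀‖_{L³} ≤ K ν`, `p`-fold symmetric about the vertical axis and mirror-symmetric in the vertical plane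
`{x₁ = 0}` for some `p ≥ N`, has a global Kato solution.  Proof: S1ᴷ + the tree's weak-`L³` stability of
local Leray solutions with stability of singular points + S2ᴰ (`profileRigidityD`) + S3
(`noSwirlL3LerayRegular_holds`).  NOT THE ROW; no summit statement is proved. -/
theorem hasGlobalKatoSolution_dihedral_of_large_order (ν K : ℝ) (hν : 0 < ν) :
    ∃ N : ℕ, ∀ p : ℕ, N ≤ p → ∀ u₀ : R3 → R3, MemLp u₀ 3 volume → IsWeaklyDivFree u₀ →
      (∀ x : R3, u₀ (rotZ (2 * Real.pi / p) x) = rotZ (2 * Real.pi / p) (u₀ x)) →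
      (∀ x : R3, u₀ (reflY x) = reflY (u₀ x)) →
      eLpNorm u₀ 3 volume ≤ ENNReal.ofReal (K * ν) → HasGlobalKatoSolution ν u₀ := by
  by_contra h
  push Not at h
  -- S1ᴷ: the normalised bad sequence
  obtain ⟨m, c, a, w, q, hm, hc, ha, hw, hsym, hmir, hsing⟩ := normalisedBadSequenceK (K := K) hν h
  -- weak `L³` stability of local Leray solutions with stability of singular points (tree theorem)
  obtain ⟨σ, a', U, P, hσ, ha'3, ha'div, ha'le, hweak, hU, hstab, -⟩ :=
    leray_solution_L3_weak_stability_holds hν (K * ν).toNNReal a w q ha hw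
  have hUsing : ∀ r : ℝ, 0 < r →
      eLpNorm (uncurry U) ∞ (volume.restrict (parabolicCylinder r ((1 : ℝ), (0 : R3)))) = ∞ :=
    hstab 1 0 one_pos (fun k r hr => hsing (σ k) r hr)
  -- S2ᴰ: the weak limit is a.e.-axisymmetric and a.e.-mirror-symmetric about some vertical axis
  obtain ⟨ξ, hξ, hax, hmx⟩ := profileRigidityD (M := (K * ν).toNNReal) (m := m ∘ σ) (c := c ∘ σ)
    (a := a ∘ σ) (f := a') (hm.comp hσ.tendsto_atTop) (fun j => hc (σ j))
    (fun j => ⟨(ha (σ j)).1, (ha (σ j)).2.2⟩) (fun j => hsym (σ j)) (fun j => hmir (σ j)) ha'3 hweak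
  -- S3: no singular point — contradiction
  obtain ⟨r, hr, hfin⟩ := noSwirlL3LerayRegular_holds ν hν ξ a' U P hξ ha'3 ha'div hax hmx hU 1 0 one_pos
  exact hfin.ne (hUsing r hr)

end KatoClass

end Summit.NavierStokesRegularity.NavierStokesRegularity.Theorems.ScenarioCensus.RowF13dLargeL3

end
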